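import Mathlib

/-!
# T5HodgeStar — the pointwise Hodge-star computation behind Lemma H2.1 of the N1 support memo
(route/T5-N1-hodge-p6.md): on a complex surface, for every (2,0)-covector β one has *β̄ = β̄, and
α ∧ β̄ = (α, β) Vol for all (2,0)-covectors α, β (Voisin, Hodge Theory and Complex Algebraic
Geometry I, Lemma 5.4 / p. 105 «(α_x, β_x) Vol_x = α_x ∧ \overline{*β}_x», Definition 5.3).

Coefficient model.  At a point of a complex surface take a unitary frame e₁, e₂ of the holomorphic
tangent space; then e₁, Ie₁, e₂, Ie₂ is a positively oriented orthonormal real basis (Voisin p. 63,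
complex orientation) with dual coframe dx₁, dy₁, dx₂, dy₂ and volume form
Vol = dx₁ ∧ dy₁ ∧ dx₂ ∧ dy₂ (Lemma 3.8).  A complex 2-covector is recorded by its six coefficients in
the orthonormal basis of wedges, in the fixed order

  index 0: dx₁∧dy₁ · 1: dx₁∧dx₂ · 2: dx₁∧dy₂ · 3: dy₁∧dx₂ · 4: dy₁∧dy₂ · 5: dx₂∧dy₂

(f₁, f₂, f₃, f₄) := (dx₁, dy₁, dx₂, dy₂).  In this model:
* `hodgeStar` is the Hodge operator *, characterised on real covectors by γ ∧ *δ = (γ, δ) Vol and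
  extended ℂ-linearly (Voisin Def. 5.3, p. 105 l. 6): *(fᵢ∧fⱼ) = ε · f_k∧f_l with {k, l} the
  complementary pair and ε the sign of the permutation (i, j, k, l);
* `wedge γ δ` is the coefficient of Vol in γ ∧ δ;
* `herm γ δ = ∑ γᵢ · conj δᵢ` is the hermitian extension of the metric on real 2-covectors for
  which the six wedges are orthonormal (Voisin p. 104 l. 7), ℂ-linear in γ and antilinear in δ;
* `dz12 = dz₁ ∧ dz₂` with dzⱼ = dxⱼ + i dyⱼ, and `twoZero b = b • dz12` is the general (2,0)-covector
  (Λ^{2,0} is one-dimensional on a surface).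

Everything is a finite computation with the six coefficients; no integration and nothing global.
The global Corollary H2.2 (∫_S α ∧ β̄ = (α, β)_{L²(S,h)}) is the integral of `wedge_conj_twoZero`
over S and is NOT formalised.  Blind lane, Mathlib only, standard axioms.
-/

namespace Summit.Ventures.HodgeRepro2.T5HodgeStar

open Complex

/-- A complex 2-covector at a point of a complex surface, by its six coefficients in the
orthonormal wedge basis `dx₁∧dy₁, dx₁∧dx₂, dx₁∧dy₂, dy₁∧dx₂, dy₁∧dy₂, dx₂∧dy₂`. -/
abbrev TwoCovector := Fin 6 → ℂ

/-- Coefficientwise complex conjugation (the real structure of the complexified covectors). -/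
def conjC (β : TwoCovector) : TwoCovector := fun i => starRingEnd ℂ (β i)

/-- The Hodge operator on 2-covectors of an oriented euclidean 4-space, in the orthonormal
oriented coframe `(f₁, f₂, f₃, f₄) = (dx₁, dy₁, dx₂, dy₂)`, `Vol = f₁∧f₂∧f₃∧f₄`:
`*(f₁∧f₂) = f₃∧f₄`, `*(f₁∧f₃) = −f₂∧f₄`, `*(f₁∧f₄) = f₂∧f₃`, `*(f₂∧f₃) = f₁∧f₄`,
`*(f₂∧f₄) = −f₁∧f₃`, `*(f₃∧f₄) = f₁∧f₂` (the sign of the permutation `(i, j, k, l)`),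
extended ℂ-linearly. -/
def hodgeStar (β : TwoCovector) : TwoCovector := ![β 5, -β 4, β 3, β 2, -β 1, β 0]

/-- The coefficient of `Vol = f₁∧f₂∧f₃∧f₄` in the wedge product `γ ∧ δ` of two 2-covectors:
`(fᵢ∧fⱼ) ∧ (f_k∧f_l) = sign(i, j, k, l) · Vol` when `{i, j, k, l} = {1, 2, 3, 4}` and `0` otherwise. -/
def wedge (γ δ : TwoCovector) : ℂ :=
  γ 0 * δ 5 + γ 5 * δ 0 - γ 1 * δ 4 - γ 4 * δ 1 + γ 2 * δ 3 + γ 3 * δ 2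

/-- The hermitian metric on complex 2-covectors for which the six wedges are orthonormal
(Voisin's `(,)` extended to `Ω²_{X,ℂ}`): linear in the first slot, antilinear in the second. -/
def herm (γ δ : TwoCovector) : ℂ := ∑ i, γ i * starRingEnd ℂ (δ i)

/-- `dz₁ ∧ dz₂ = (dx₁ + i dy₁) ∧ (dx₂ + i dy₂) = dx₁∧dx₂ + i dx₁∧dy₂ + i dy₁∧dx₂ − dy₁∧dy₂`. -/
def dz12 : TwoCovector := ![0, 1, I, I, -1, 0]

/-- The general (2,0)-covector `b · dz₁ ∧ dz₂`. -/
def twoZero (b : ℂ) : TwoCovector := b • dz12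

/-- `*` is an involution on 2-covectors in dimension 4 (Voisin Lemma 5.5: `*² = (−1)^{k(n−k)}`,
here `k = 2`, `n = 4`). -/
theorem hodgeStar_hodgeStar (β : TwoCovector) : hodgeStar (hodgeStar β) = β := by
  ext i; fin_cases i <;> simp [hodgeStar]

/-- `*` is ℂ-linear. -/
theorem hodgeStar_smul (c : ℂ) (β : TwoCovector) : hodgeStar (c • β) = c • hodgeStar β := by
  ext i; fin_cases i <;> simp [hodgeStar, mul_neg]

/-- `*` commutes with the real structure (it is the ℂ-linear extension of a real operator). -/
theorem hodgeStar_conjC (β : TwoCovector) : hodgeStar (conjC β) = conjC (hodgeStar β) := by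
  ext i; fin_cases i <;> simp [hodgeStar, conjC]

/-- Voisin's defining identity in the coefficient model: `γ ∧ \overline{*δ} = (γ, δ) · Vol`
(p. 105 l. 6: «(α_x, β_x) Vol_x = α_x ∧ \overline{*β}_x»). -/
theorem wedge_conjC_hodgeStar (γ δ : TwoCovector) : wedge γ (conjC (hodgeStar δ)) = herm γ δ := by
  simp only [wedge, herm, hodgeStar, conjC, Fin.sum_univ_succ, Fin.sum_univ_zero]
  simp
  ring

/-- For real covectors (`γ = conjC γ`, `δ = conjC δ`) this is the real identity
`γ ∧ *δ = (γ, δ) Vol` of Voisin Lemma 5.4. -/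
theorem wedge_hodgeStar_of_real (γ δ : TwoCovector) (hδ : conjC δ = δ) :
    wedge γ (hodgeStar δ) = herm γ δ := by
  rw [← wedge_conjC_hodgeStar, ← hodgeStar_conjC, hδ]

/-- A (2,0)-covector is self-dual: `*(b dz₁∧dz₂) = b dz₁∧dz₂`. -/
theorem hodgeStar_twoZero (b : ℂ) : hodgeStar (twoZero b) = twoZero b := by
  ext i; fin_cases i <;> simp [hodgeStar, twoZero, dz12]

/-- The conjugate of a (2,0)-covector is self-dual: `*\overline{β} = \overline{β}` for
`β = b dz₁∧dz₂` — the computation in the proof of Lemma H2.1 (and the case `k = n = 2`,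
`(p,q) = (2,0)` of the formula `*\overline{α̃} = (−1)^{k(k−1)/2} i^{p−q} \overline{α̃}` in the proof
of Voisin Theorem 6.32, p. 129). -/
theorem hodgeStar_conjC_twoZero (b : ℂ) : hodgeStar (conjC (twoZero b)) = conjC (twoZero b) := by
  rw [hodgeStar_conjC, hodgeStar_twoZero]

/-- Lemma H2.1: for (2,0)-covectors `α = a dz₁∧dz₂`, `β = b dz₁∧dz₂`,
`α ∧ \overline{β} = (α, β) · Vol`. -/
theorem wedge_conjC_twoZero (a b : ℂ) :
    wedge (twoZero a) (conjC (twoZero b)) = herm (twoZero a) (twoZero b) := by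
  rw [← wedge_conjC_hodgeStar, hodgeStar_twoZero]

/-- The value: `(a dz₁∧dz₂, b dz₁∧dz₂) = 4 a \overline{b}` (so `‖dz₁ ∧ dz₂‖² = 4` in this
normalisation). -/
theorem herm_twoZero (a b : ℂ) : herm (twoZero a) (twoZero b) = 4 * a * starRingEnd ℂ b := by
  simp only [herm, twoZero, dz12, Fin.sum_univ_succ, Fin.sum_univ_zero]
  simp
  linear_combination (-2 * a * starRingEnd ℂ b) * Complex.I_sq

/-- `α ∧ \overline{β} = 4 a \overline{b} · Vol` — the constant checked against
T4-A3-p5 Lemma A7.1 in the memo. -/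
theorem wedge_conjC_twoZero_eq (a b : ℂ) :
    wedge (twoZero a) (conjC (twoZero b)) = 4 * a * starRingEnd ℂ b := by
  rw [wedge_conjC_twoZero, herm_twoZero]

/-- Positivity (pointwise Hodge–Riemann for type (2,0) on a surface, H3): `α ∧ \overline{α}` is
`4|a|² · Vol`, real and `> 0` for `α ≠ 0`. -/
theorem wedge_conjC_twoZero_self (a : ℂ) :
    wedge (twoZero a) (conjC (twoZero a)) = (4 * normSq a : ℝ) := by
  rw [wedge_conjC_twoZero_eq, mul_assoc, Complex.mul_conj]
  push_cast
  ring

/-- `α ∧ \overline{α}` has positive real part for `α = a dz₁∧dz₂ ≠ 0`: the pairing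
`(α, α) = ∫_S α ∧ \overline{α}` of H3 is positive definite on `H^{2,0}(S)`. -/
theorem wedge_conjC_twoZero_self_pos {a : ℂ} (ha : a ≠ 0) :
    0 < (wedge (twoZero a) (conjC (twoZero a))).re := by
  rw [wedge_conjC_twoZero_self, Complex.ofReal_re]
  have : 0 < normSq a := normSq_pos.mpr ha
  linarith

/-- The (2,0)-covectors are exactly the multiples of `dz₁ ∧ dz₂`: the identities above cover every
element of the line `ℂ · dz12`. -/
theorem mem_span_dz12_iff (β : TwoCovector) :
    β ∈ Submodule.span ℂ {dz12} ↔ ∃ b : ℂ, β = twoZero b := by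
  rw [Submodule.mem_span_singleton]
  constructor
  · rintro ⟨b, rfl⟩; exact ⟨b, rfl⟩
  · rintro ⟨b, rfl⟩; exact ⟨b, rfl⟩

end Summit.Ventures.HodgeRepro2.T5HodgeStar
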